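import Mathlib
import HarnessLib
import Summits.Ventures.LatticeQCDFlow.Exactness.SphereExpMapMinorisation
import Summits.Ventures.LatticeQCDFlow.Exactness.SphereFamilyLeapfrogHMCErgodic

/-!
# The momentum cylinder of a sphere family: sitewise axis coordinates in rotated frames, and Fubini along all the axes at once

HONEST FRAMING: exact (Metropolis-corrected) sampling algorithms for lattice gauge theory;
figures of merit are autocorrelation/cost numbers at stated couplings and volumes; no
continuum-physics claim.

Venture `LatticeQCDFlow` (cell pub-lqcd), topic `Exactness`, FANOUT row 9 (eng-latcore; roadmap Step 4 bookkeeping toward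
MULTI-STEP HMC on the `cpn_2d` sphere family, HOME/eng-latcore/HANDOFF.md GEN-19/20).  NEW WORK of the cell over the tree
(row 7's `SphereAxisCoordinates.lean`: `axisCoords`, `measurePreserving_axisCoords`, `axisCoords_symm_apply_eq`,
`norm_sq_axisCoords_symm`; gen-16's `SphereExpMapChart.lean` / `SphereExpMapMinorisation.lean`: `polarAxisPt`,
`map_restrict_axisCylinder` (ONE sphere at the pole); `SphereFamilyLeapfrog.lean`: `FamE`, `FamS`, `piProdMEquiv`,
`measurePreserving_piProdMEquiv`; `SphereFamilyLeapfrogHMCErgodic.lean`: `famMomBox`; `SphereFrameLift.lean` /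
`SphereOrbitLaw.lean`: `rotSO`, `actSO`, `coe_actSO_eq_rotSO`; `SphereDriftLift.lean`: `tangentialPart`) and Mathlib
(`measurePreserving_pi`, `Measure.restrict_pi_pi`, `Measure.prod_restrict`, `Measure.map_snd_prod`, `Measure.pi_univ`,
`LinearIsometryEquiv.measurePreserving`); nothing is cited as a fact; the only number is `2^{|ι|} = |(-1,1)|^{|ι|}`.

THE POINT.  The `n`-step proposal of the family leapfrog sees the ambient momenta only through their tangential parts
(`SphereFamilyLeapfrogNormal.fst_famProposal_famTangential`).  To turn Lebesgue measure on a momentum box into Lebesgue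
measure on the product of TANGENT balls (where the trajectory analysis lives), fix at every site a rotation `O i` taking
the pole `e₀` to `x i`, read `p i` in the axis coordinates of the rotated frame — `p i = t • x i + O i (0, y i)` — and
integrate out the normal coordinates `t ∈ (-1, 1)` all at once:

* `famAxisCoords O : (Π i, ℝ^{k i+2}) ≃ᵐ Π i, ℝ × ℝ^{k i+1}` (`measurePreserving_famAxisCoords`), `famTanLift O y = (O i (0, y i))ᵢ`,
  **`tangentialPart_eq_famTanLift`** (`O i e₀ = x i` ⇒ the tangential part of `p i` at `x i` is `O i (0, (famAxisCoords O p i).2)`),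
  `inner_famTanLift` (it is tangent), `norm_famTanLift` (sitewise isometric).
* `famCylinder O a` = `{p : |t i| < 1, ‖y i‖ < a ∀ i}`; `famCylinder_subset_famMomBox` (`⊆ famMomBox (a + 1)`).
* **`map_restrict_famCylinder`** — for measurable `f` on momenta factoring through the tangent coordinates, `f p = g (y(p))`:
  `((⊗ᵢ Leb)|_{famCylinder O a}).map f = 2^{|ι|} • ((⊗ᵢ Leb_{ℝ^{k i+1}})|_{Πᵢ ball 0 a}).map g`.

NOT CLAIMED: the position law / minorisation itself (roadmap Steps 1–2 for families, 4, 5), any other constant.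
-/

noncomputable section

namespace Summit.Ventures.LatticeQCDFlow.Exactness

open MeasureTheory Measure Metric Set Real
open scoped ENNReal InnerProductSpace

section Family

variable {ι : Type*} {k : ι → ℕ}

/-! ## §1 Sitewise axis coordinates in rotated frames -/

/-- **Sitewise axis coordinates in the frames `O i`**: `p ↦ (axisCoords (O i⁻¹ p i))ᵢ`, a measurable equivalence
`(Π i, ℝ^{k i+2}) ≃ᵐ Π i, ℝ × ℝ^{k i+1}`. -/
def famAxisCoords (O : Π i, Matrix.specialOrthogonalGroup (Fin (k i + 2)) ℝ) :
    (Π i, FamE k i) ≃ᵐ Π i, ℝ × EuclideanSpace ℝ (Fin (k i + 1)) :=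
  MeasurableEquiv.piCongrRight fun i => ((rotSO (O i)).symm.toMeasurableEquiv).trans (axisCoords (k i))

/-- Pointwise: `famAxisCoords O p i = axisCoords (O i⁻¹ (p i))`. -/
theorem famAxisCoords_apply (O : Π i, Matrix.specialOrthogonalGroup (Fin (k i + 2)) ℝ) (p : Π i, FamE k i) (i : ι) :
    famAxisCoords O p i = axisCoords (k i) ((rotSO (O i)).symm (p i)) := rfl

/-- Pointwise inverse: `(famAxisCoords O)⁻¹ w i = O i ((axisCoords)⁻¹ (w i))`. -/
theorem famAxisCoords_symm_apply (O : Π i, Matrix.specialOrthogonalGroup (Fin (k i + 2)) ℝ)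
    (w : Π i, ℝ × EuclideanSpace ℝ (Fin (k i + 1))) (i : ι) :
    (famAxisCoords O).symm w i = rotSO (O i) ((axisCoords (k i)).symm (w i)) := rfl

/-- **Sitewise axis coordinates are volume preserving** (each rotation and each `axisCoords` is). -/
theorem measurePreserving_famAxisCoords [Fintype ι] (O : Π i, Matrix.specialOrthogonalGroup (Fin (k i + 2)) ℝ) :
    MeasurePreserving (famAxisCoords O) (Measure.pi fun i => (volume : Measure (FamE k i)))
      (Measure.pi fun i => (volume : Measure ℝ).prod (volume : Measure (EuclideanSpace ℝ (Fin (k i + 1))))) :=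
  measurePreserving_pi _ _ fun i => ((rotSO (O i)).symm.measurePreserving).trans (measurePreserving_axisCoords (k i))

/-- **The tangential lift** of tangent coordinates: `y ↦ (O i (0, y i))ᵢ`. -/
def famTanLift (O : Π i, Matrix.specialOrthogonalGroup (Fin (k i + 2)) ℝ) (y : Π i, EuclideanSpace ℝ (Fin (k i + 1))) :
    Π i, FamE k i :=
  fun i => rotSO (O i) (equatorEmbed (k i) (y i))

/-- The lift is sitewise isometric. -/
theorem norm_famTanLift (O : Π i, Matrix.specialOrthogonalGroup (Fin (k i + 2)) ℝ)
    (y : Π i, EuclideanSpace ℝ (Fin (k i + 1))) (i : ι) : ‖famTanLift O y i‖ = ‖y i‖ := by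
  rw [famTanLift, LinearIsometryEquiv.norm_map, norm_equatorEmbed]

/-- The lift is measurable (continuous linear at every site). -/
theorem measurable_famTanLift (O : Π i, Matrix.specialOrthogonalGroup (Fin (k i + 2)) ℝ) : Measurable (famTanLift O) :=
  measurable_pi_lambda _ fun i =>
    ((rotSO (O i)).continuous.measurable.comp (equatorEmbed (k i)).continuous.measurable).comp (measurable_pi_apply i)

/-- **The lift is tangent** at `x i = O i e₀`: `⟪x i, O i (0, y i)⟫ = 0`. -/
theorem inner_famTanLift {O : Π i, Matrix.specialOrthogonalGroup (Fin (k i + 2)) ℝ} {x : Π i, FamS k i}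
    (hO : ∀ i, actSO (O i) (polarAxisPt (k i)) = x i) (y : Π i, EuclideanSpace ℝ (Fin (k i + 1))) (i : ι) :
    ⟪(x i : FamE k i), famTanLift O y i⟫_ℝ = 0 := by
  rw [← hO i, coe_actSO_eq_rotSO, coe_polarAxisPt, famTanLift, LinearIsometryEquiv.inner_map_map,
    inner_polarAxis_equatorEmbed]

/-- A momentum in the rotated axis coordinates: `p i = t • x i + O i (0, y)` with `(t, y) = famAxisCoords O p i`. -/
theorem eq_axis_add_famTanLift {O : Π i, Matrix.specialOrthogonalGroup (Fin (k i + 2)) ℝ} {x : Π i, FamS k i}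
    (hO : ∀ i, actSO (O i) (polarAxisPt (k i)) = x i) (p : Π i, FamE k i) (i : ι) :
    p i = (famAxisCoords O p i).1 • (x i : FamE k i) + rotSO (O i) (equatorEmbed (k i) (famAxisCoords O p i).2) := by
  have h : (rotSO (O i)).symm (p i) = (axisCoords (k i)).symm (famAxisCoords O p i) := by
    rw [famAxisCoords_apply, MeasurableEquiv.symm_apply_apply]
  rw [← Prod.mk.eta (p := famAxisCoords O p i), axisCoords_symm_apply_eq] at h
  have h2 : p i = rotSO (O i) ((famAxisCoords O p i).1 • polarAxis (k i) + equatorEmbed (k i) (famAxisCoords O p i).2) := by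
    rw [← h, LinearIsometryEquiv.apply_symm_apply]
  rw [h2, map_add, map_smul, ← hO i, coe_actSO_eq_rotSO, coe_polarAxisPt]

/-- **THE TANGENTIAL PART IN THE ROTATED FRAME**: with `O i e₀ = x i`, the tangential part of `p i` at `x i` is the lift of
its tangent coordinate, `O i (0, (famAxisCoords O p i).2)`. -/
theorem tangentialPart_eq_famTanLift {O : Π i, Matrix.specialOrthogonalGroup (Fin (k i + 2)) ℝ} {x : Π i, FamS k i}
    (hO : ∀ i, actSO (O i) (polarAxisPt (k i)) = x i) (p : Π i, FamE k i) (i : ι) :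
    tangentialPart (x i, p i) = famTanLift O (fun j => (famAxisCoords O p j).2) i := by
  have hx : ‖(x i : FamE k i)‖ = 1 := norm_eq_of_mem_sphere (x i)
  have htan : ⟪(x i : FamE k i), rotSO (O i) (equatorEmbed (k i) (famAxisCoords O p i).2)⟫_ℝ = 0 :=
    inner_famTanLift hO (fun j => (famAxisCoords O p j).2) i
  unfold tangentialPart
  change p i - ⟪(x i : FamE k i), p i⟫_ℝ • (x i : FamE k i) = rotSO (O i) (equatorEmbed (k i) (famAxisCoords O p i).2)
  conv_lhs => rw [eq_axis_add_famTanLift hO p i]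
  rw [inner_add_right, real_inner_smul_right, real_inner_self_eq_norm_sq, hx, one_pow, mul_one, htan, add_zero,
    add_sub_cancel_left]

/-! ## §2 The cylinder -/

/-- **The momentum cylinder** in the frames `O`: `|t i| < 1` and `‖y i‖ < a` at every site. -/
def famCylinder (O : Π i, Matrix.specialOrthogonalGroup (Fin (k i + 2)) ℝ) (a : ℝ) : Set (Π i, FamE k i) :=
  famAxisCoords O ⁻¹' Set.pi univ fun i => Ioo (-1 : ℝ) 1 ×ˢ ball (0 : EuclideanSpace ℝ (Fin (k i + 1))) a

/-- The cylinder is measurable. -/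
theorem measurableSet_famCylinder [Fintype ι] (O : Π i, Matrix.specialOrthogonalGroup (Fin (k i + 2)) ℝ) (a : ℝ) :
    MeasurableSet (famCylinder O a) :=
  (famAxisCoords O).measurable (MeasurableSet.univ_pi fun _ => measurableSet_Ioo.prod measurableSet_ball)

/-- **The cylinder sits in the momentum box of radius `a + 1`** (`‖p i‖² = t² + ‖y‖² < 1 + a²`). -/
theorem famCylinder_subset_famMomBox (O : Π i, Matrix.specialOrthogonalGroup (Fin (k i + 2)) ℝ) {a : ℝ} (ha : 0 ≤ a) :
    famCylinder O a ⊆ famMomBox k (a + 1) := by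
  intro p hp i _
  have hpi := hp i (mem_univ i)
  rw [mem_prod, mem_Ioo, mem_ball_zero_iff] at hpi
  rw [mem_ball_zero_iff]
  have hnorm : ‖p i‖ = ‖(axisCoords (k i)).symm (famAxisCoords O p i)‖ := by
    rw [famAxisCoords_apply, MeasurableEquiv.symm_apply_apply, LinearIsometryEquiv.norm_map]
  have hsq : ‖p i‖ ^ 2 = (famAxisCoords O p i).1 ^ 2 + ‖(famAxisCoords O p i).2‖ ^ 2 := by
    rw [hnorm, ← Prod.mk.eta (p := famAxisCoords O p i), norm_sq_axisCoords_symm]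
  have h1 : (famAxisCoords O p i).1 ^ 2 < 1 := by nlinarith [hpi.1.1, hpi.1.2]
  have h2 : ‖(famAxisCoords O p i).2‖ ^ 2 ≤ a ^ 2 := pow_le_pow_left₀ (norm_nonneg _) hpi.2.le 2
  have h3 : ‖p i‖ ^ 2 < (a + 1) ^ 2 := by rw [hsq]; nlinarith
  exact lt_of_pow_lt_pow_left₀ 2 (by linarith) h3

/-! ## §3 Fubini along all the axes -/

/-- **FUBINI ALONG ALL THE AXES.**  Lebesgue measure on the cylinder, pushed through a measurable map of the momenta that
factors through the tangent coordinates, is `2^{|ι|} •` the push-forward of product Lebesgue measure on the product of the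
tangent balls (`2 = |(-1, 1)|` per site). -/
theorem map_restrict_famCylinder [Fintype ι] {X : Type*} [MeasurableSpace X] (O : Π i, Matrix.specialOrthogonalGroup (Fin (k i + 2)) ℝ)
    (a : ℝ) {g : (Π i, EuclideanSpace ℝ (Fin (k i + 1))) → X} (hg : Measurable g)
    {f : (Π i, FamE k i) → X} (hf : Measurable f) (hfg : ∀ p, f p = g fun i => (famAxisCoords O p i).2) :
    ((Measure.pi fun i => (volume : Measure (FamE k i))).restrict (famCylinder O a)).map f =
      (2 : ℝ≥0∞) ^ Fintype.card ι •
        ((Measure.pi fun i => (volume : Measure (EuclideanSpace ℝ (Fin (k i + 1))))).restrict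
          (Set.pi univ fun i => ball (0 : EuclideanSpace ℝ (Fin (k i + 1))) a)).map g := by
  classical
  set e := famAxisCoords (k := k) O with he
  -- Lebesgue measure on the momenta in the sitewise axis coordinates
  have hvol : (Measure.pi fun i => (volume : Measure (FamE k i))) =
      (Measure.pi fun i => (volume : Measure ℝ).prod (volume : Measure (EuclideanSpace ℝ (Fin (k i + 1))))).map e.symm :=
    ((measurePreserving_famAxisCoords O).symm _).map_eq.symm
  have hfs : f ∘ e.symm = (g ∘ Prod.snd) ∘ (piProdMEquiv (α := fun _ : ι => ℝ)
      (β := fun i => EuclideanSpace ℝ (Fin (k i + 1)))) := by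
    funext w
    rw [Function.comp_apply, hfg, Function.comp_apply, Function.comp_apply, piProdMEquiv_apply]
    congr 1
    funext i
    rw [he, MeasurableEquiv.apply_symm_apply]
  have hpre : e.symm ⁻¹' famCylinder O a =
      Set.pi univ fun i => Ioo (-1 : ℝ) 1 ×ˢ ball (0 : EuclideanSpace ℝ (Fin (k i + 1))) a :=
    MeasurableEquiv.symm_preimage_preimage _ _
  rw [hvol, Measure.restrict_map e.symm.measurable (measurableSet_famCylinder O a), Measure.map_map hf e.symm.measurable,
    hfs, hpre, Measure.restrict_pi_pi]
  simp_rw [← Measure.prod_restrict]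
  rw [← Measure.map_map (hg.comp measurable_snd) (piProdMEquiv (α := fun _ : ι => ℝ)
      (β := fun i => EuclideanSpace ℝ (Fin (k i + 1)))).measurable,
    (measurePreserving_piProdMEquiv (fun _ : ι => (volume : Measure ℝ).restrict (Ioo (-1 : ℝ) 1))
      (fun i => (volume : Measure (EuclideanSpace ℝ (Fin (k i + 1)))).restrict (ball 0 a))).map_eq,
    ← Measure.map_map hg measurable_snd, Measure.map_snd_prod, Measure.map_smul, Measure.pi_univ,
    ← Measure.restrict_pi_pi]
  congr 1
  simp only [Measure.restrict_apply_univ, Real.volume_Ioo]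
  norm_num

end Family

end Summit.Ventures.LatticeQCDFlow.Exactness

end
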